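import Summits.BirchSwinnertonDyer.BirchSwinnertonDyer.Theorems.SignedLowerHalvesSmallImageLowerHalfBothSignsRttCharRoadE1CoresDescent
import HarnessLib

/-!
# Route `SignedLowerHalves`, crux L `SmallImageLowerHalfBothSigns` (stmt-BirchSwinnertonDyer-23599), line `rtt_w3` v12 — glue brick I′ (NATURALITY OF THE INDEX-TWO
# TRANSFER IN THE COEFFICIENTS): for a `G`-equivariant additive `ψ : M → M'` between discrete `G`-modules, `ψ_* ∘ cor = cor ∘ ψ_*` on `H¹(N, M) → H¹(G, M')`
# (the tree's explicit transfer `corH1` of `Literature/…/H1CorestrictionIndexTwo`, `F(n) = f(n) + c·f(c⁻¹nc)`, `F(nc) = F(n) + n·f(c²)`, is built from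
# values of `f` by sums and `G`-translates, all of which `ψ` respects). In the glue this links BLOCK I (cores pair on `W[p] = geomTorsion W p`, p767436)
# with BLOCK DESC (cor on `W[p^∞]`-classes, -w3 g17 `resOfLe_corH1_mem_condAbove_sgn`) along the inclusion `ψ : W[p] ↪ W[p^∞]`.

LEAD `cruxlead-stmt-BirchSwinnertonDyer-23599` g7 (cell `bsd-ssimc`; `--supports stmt-BirchSwinnertonDyer-23599 --as helper`). THEOREMS ONLY (no definition, no named fact,
no instance, no `sorry`); generic continuous group cohomology. BSD / crux L / INJ_top are NOT proved here.

WHAT: `corFun_comp` (value-level), ★ `resH1Hom_corH1_comm` (class-level naturality `ψ_* (cor ξ) = cor (ψ_* ξ)`).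

References: [SerreGaloisCohomology1997] I §2.4 (functoriality), I §5.8; [NeukirchSchmidtWingberg2008] (1.5.x) (cor on cochains).
-/

set_option autoImplicit false
set_option linter.dupNamespace false -- D-0017: single-problem summit, the namespace repeats the problem name by design
noncomputable section

open scoped Classical

universe u

namespace Summit.BirchSwinnertonDyer.BirchSwinnertonDyer.Theorems.SmallImageCharSignedSelmer

open Literature.NumberTheory.EllipticCurves Literature.NumberTheory.GaloisRepresentations

variable {G : Type u} [Group G] [TopologicalSpace G] [IsTopologicalGroup G] {N : Subgroup G} [N.Normal] {c : G}
  {M M' : Type u} [AddCommGroup M] [DistribMulAction G M] [TopologicalSpace M] [DiscreteTopology M]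
  [AddCommGroup M'] [DistribMulAction G M'] [TopologicalSpace M'] [DiscreteTopology M']

omit [TopologicalSpace G] [IsTopologicalGroup G] [N.Normal] [TopologicalSpace M] [DiscreteTopology M] [TopologicalSpace M'] [DiscreteTopology M'] in
/-- A `G`-equivariant additive map commutes with the action of a subgroup element (bookkeeping). [folklore] -/
theorem map_subgroup_smul (ψ : M →+ M') (hψ : ∀ (g : G) (m : M), ψ (g • m) = g • ψ m) (x : N) (m : M) :
    ψ (x • m) = x • ψ m :=
  hψ (x : G) m

/-- **The transfer formula commutes with equivariant coefficient maps** (value level): `corFun (ψ ∘ f) g = ψ (corFun f g)`.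
[cite: SerreGaloisCohomology1997, I §2.4] -/
theorem corFun_comp (hc : ∀ b : G, Xor (b * c⁻¹ ∈ N) (b ∈ N)) (ψ : M →+ M') (hψ : ∀ (g : G) (m : M), ψ (g • m) = g • ψ m)
    (f : contOneCocycles (discreteTopRep N M)) (f' : contOneCocycles (discreteTopRep N M')) (hf' : ∀ n : N, f'.1 n = ψ (f.1 n)) (g : G) :
    corFun hc f' g = ψ (corFun hc f g) := by
  by_cases hg : g ∈ N
  · have h1 : corFun hc f g = (symCocycle c f).1 ⟨g, hg⟩ := corFun_coe hc f ⟨g, hg⟩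
    have h2 : corFun hc f' g = (symCocycle c f').1 ⟨g, hg⟩ := corFun_coe hc f' ⟨g, hg⟩
    rw [h1, h2, symCocycle_apply, symCocycle_apply, hf', hf', map_add, hψ]
  · rw [corFun, dif_neg hg, corFun, dif_neg hg, symCocycle_apply, symCocycle_apply, hf', hf', hf', map_add, map_add, hψ, hψ]

/-- ★ **Naturality of the index-two corestriction in the coefficients**: for `ψ : M → M'` additive and `G`-equivariant, `ψ_* (cor ξ) = cor (ψ_* ξ)` in `H¹(G, M')`
for every `ξ ∈ H¹(N, M)` (`ψ_*` = the tree's `resH1Hom id ψ`). [cite: SerreGaloisCohomology1997, I §2.4, I §5.8] [cite: NeukirchSchmidtWingberg2008, (1.5.7)] -/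
theorem resH1Hom_corH1_comm (hN : IsOpen (N : Set G)) (hM : ∀ m : M, Continuous fun g : G ↦ g • m) (hM' : ∀ m' : M', Continuous fun g : G ↦ g • m')
    (hc : ∀ b : G, Xor (b * c⁻¹ ∈ N) (b ∈ N)) (ψ : M →+ M') (hψ : ∀ (g : G) (m : M), ψ (g • m) = g • ψ m) (ξ : subgroupH1 N M) :
    resH1Hom (ContinuousMonoidHom.id G) ψ hψ (corH1 hN hM hc ξ) =
      corH1 hN hM' hc (resH1Hom (ContinuousMonoidHom.id N) ψ (map_subgroup_smul ψ hψ) ξ) := by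
  obtain ⟨f, rfl⟩ := oneCocycleClass_surjective _ ξ
  -- `ψ_* [f] = [ψ ∘ f]` on `N` and `ψ_* [cor f] = [ψ ∘ cor f]` on `G`
  have hN' : resH1Hom (ContinuousMonoidHom.id N) ψ (map_subgroup_smul ψ hψ) (oneCocycleClass _ f) =
      oneCocycleClass (discreteTopRep N M')
        (contOneCocycles.pullback (ContinuousMonoidHom.id N) (resHomOfEquivariant (ContinuousMonoidHom.id N) ψ (map_subgroup_smul ψ hψ)) f) :=
    map_oneCocycleClass (X := discreteTopRep N M) (Y := discreteTopRep N M') (ContinuousMonoidHom.id N)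
      (resHomOfEquivariant (ContinuousMonoidHom.id N) ψ (map_subgroup_smul ψ hψ)) f
  have hG' : resH1Hom (ContinuousMonoidHom.id G) ψ hψ (oneCocycleClass _ (corCocycle hN hM hc f)) =
      oneCocycleClass (discreteTopRep G M')
        (contOneCocycles.pullback (ContinuousMonoidHom.id G) (resHomOfEquivariant (ContinuousMonoidHom.id G) ψ hψ) (corCocycle hN hM hc f)) :=
    map_oneCocycleClass (X := discreteTopRep G M) (Y := discreteTopRep G M') (ContinuousMonoidHom.id G)
      (resHomOfEquivariant (ContinuousMonoidHom.id G) ψ hψ) (corCocycle hN hM hc f)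
  rw [corH1_oneCocycleClass, hG', hN', corH1_oneCocycleClass]
  congr 1
  apply Subtype.ext
  ext g
  change ψ ((corCocycle hN hM hc f).1 g) = (corCocycle hN hM' hc _).1 g
  rw [corCocycle_apply, corCocycle_apply, corFun_comp hc ψ hψ f _ (fun n ↦ rfl)]

end Summit.BirchSwinnertonDyer.BirchSwinnertonDyer.Theorems.SmallImageCharSignedSelmer

end
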